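import Summits.BirchSwinnertonDyer.BirchSwinnertonDyer.Theorems.AlignedTransportAtTwoMainConjectureOfRankZeroBSDAtTwoFineRoadArchNettingRel
import HarnessLib

/-! # v7 FRAGMENT (att-p3 g3, attach seat — NOT a skeleton, NOT registered): the displayed Prop K₂ⁿᵉᵗʳ and its
by-name glue to skeleton v6's registered stub MuIneqʳ, ready to paste into `Lines/birth.lean` (namespace `…Birth`)
by the successor LEAD. `MuInequalityRelAtTwo` is repeated from v6 verbatim only so that this fragment elaborates
stand-alone; in `Lines/birth.lean` keep the existing one. Kernel: p601771
`…Theorems.AlignedTransportAtTwoFineRoad.muInequalityRelAtTwo_of_katoNetDataRel`. BSD is not proved by any of this;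
nothing asserted (both Props displayed). -/

set_option linter.dupNamespace false

noncomputable section

namespace Summit.BirchSwinnertonDyer.BirchSwinnertonDyer.Cruxes.MainConjectureOfRankZeroBSDAtTwo.Birth

open Summit.BirchSwinnertonDyer.BirchSwinnertonDyer.Theses.AlignedTransportAtTwo
open WeierstrassCurve Summit.BirchSwinnertonDyer.Rank1Residual.X5
open Literature.NumberTheory.EllipticCurves Literature.NumberTheory.EllipticCurves.ModularForms CongruenceSubgroup
  Literature.NumberTheory.EllipticCurves.Greenberg1999 Literature.NumberTheory.IwasawaTheory
  Summit.BirchSwinnertonDyer.Rank1Residual.F1Sign2 Summit.BirchSwinnertonDyer.Rank1Residual.X1.MuLambda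
  Summit.BirchSwinnertonDyer.BirchSwinnertonDyer.Theorems.Rank1ResidualX1Defs
  Literature.NumberTheory.EllipticCurves.Module

/-- ROAD (b″) NETTED, REGISTERED STUB (MuIneqʳ): Kato's `μ`-inequality at `2` against the RELAXED-at-∞ fine dual —
`ℓ₍₂₎(X(W/ℚ_∞)) ≤ ℓ₍₂₎(Λ/(G₊)) + ℓ₍₂₎(X₀^{rel∞}(W/ℚ_∞))` for every `W` good ordinary at `2` with no rational `2`-torsion, every
cyclotomic datum, newform, integral lift `G₊` of `L₂(f, α)`, every `D : SelmerDualData` and `Yr : FineSelmerDualDataRelaxedInf`.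
PRINT pending typing for BOTH signs of `Δ_W` (Kato §17.13 over `ℚ(ζ_{2^∞})`, Prop 17.11, REF1 §57 period `2^{[Δ>0]}` netted
against Greenberg's `X^{rel∞}/X^{str} = (Λ/2)^{[Δ>0]}`, LNM 1716 L.4.6; crux note ARCH-NETTING.md). Nothing asserted. -/
def MuInequalityRelAtTwo : Prop :=
  ∀ (W : WeierstrassCurve ℚ) [W.IsElliptic] [W.IsGloballyMinimal], IsOrdinaryAt W 2 →
    (∀ x : ℚ, ¬ HasRationalTwoTorsionX W x) →
    ∀ (κ : ZpExtension ℚ 2) (γ : Field.absoluteGaloisGroup ℚ), κ.IsCyclotomic →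
    κ.IsTopGenerator γ → IsCyclotomicVariable 2 γ →
    ∀ ⦃N : ℕ⦄ [NeZero N] (f : CuspForm (Gamma0 N) 2), IsNewformOf W f →
    ∀ Gp : IwasawaAlgebra 2, iwasawaToPowerSeries 2 Gp = padicLFunction f (unitRoot W 2 : ℚ_[2]) →
    ∀ (D : W.SelmerDualData κ γ) (Yr : W.FineSelmerDualDataRelaxedInf κ γ),
      Literature.NumberTheory.EllipticCurves.Module.lengthAt (IwasawaAlgebra 2) D.X
          ⟨IwasawaAlgebra.augIdealP 2, IwasawaAlgebra.isPrime_augIdealP_holds 2⟩ ≤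
        Literature.NumberTheory.EllipticCurves.Module.lengthAt (IwasawaAlgebra 2)
            (IwasawaAlgebra 2 ⧸ Ideal.span {Gp})
            ⟨IwasawaAlgebra.augIdealP 2, IwasawaAlgebra.isPrime_augIdealP_holds 2⟩ +
          Literature.NumberTheory.EllipticCurves.Module.lengthAt (IwasawaAlgebra 2) Yr.X
            ⟨IwasawaAlgebra.augIdealP 2, IwasawaAlgebra.isPrime_augIdealP_holds 2⟩

/-- DISPLAYED (road (b″) netted, K₂ⁿᵉᵗʳ — the typer's checklist behind MuIneqʳ): for every `W` good ordinary at `2`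
without rational `2`-torsion, cyclotomic datum, newform, integral lift `G₊`, `D : SelmerDualData`, `Yr : FineSelmerDualDataRelaxedInf`:
Kato's row `P → X' → Y' → 0` over `ℚ(ζ_{2^∞})` with `Δ`-action (`X' = X(E/K_∞)`, `Y' = X₀(E/K_∞)`), an injective `Δ`-equivariant
Coleman map with finite cokernel (17.11), zeta images `w₁ ↦ (a,b)`, `w₂ ↦ (b,a)` in `ker toX` with `a + b = 2^e·s·G₊`, `s ∉ (2)`
(REF1 §57: `e = [Δ_W > 0]` for the best integral class), a RELAXED descent `fd : X'_Δ → X^{rel}` with finite cokernel (inf–res),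
the archimedean extension `q : X^{rel} ↠ X(W/ℚ_∞)` with `e ≤ ℓ₍₂₎(ker q)` (Greenberg L.4.6 at `2`: `(Λ/2)^{[Δ>0]}`), and a fine
comparison `fyʳ : Y'_Δ → X₀^{rel∞}(W/ℚ_∞)` with `ℓ₍₂₎(ker fyʳ) = 0` (inf–res, target relaxed at `∞`). PRINT pending typing for
BOTH signs; the `∃`-over-Types shape certifies no provenance. Nothing asserted. -/
def KatoNetDataRelAtTwo : Prop :=
  ∀ (W : WeierstrassCurve ℚ) [W.IsElliptic] [W.IsGloballyMinimal], IsOrdinaryAt W 2 →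
  (∀ x : ℚ, ¬ HasRationalTwoTorsionX W x) →
  ∀ (κ : ZpExtension ℚ 2) (γ : Field.absoluteGaloisGroup ℚ), κ.IsCyclotomic →
  κ.IsTopGenerator γ → IsCyclotomicVariable 2 γ →
  ∀ ⦃N : ℕ⦄ [NeZero N] (f : CuspForm (Gamma0 N) 2), IsNewformOf W f →
  ∀ Gp : IwasawaAlgebra 2, iwasawaToPowerSeries 2 Gp = padicLFunction f (unitRoot W 2 : ℚ_[2]) →
  ∀ (D : W.SelmerDualData κ γ) (Yr : W.FineSelmerDualDataRelaxedInf κ γ),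
    ∃ (P X' Y' Xr : Type) (_ : AddCommGroup P) (_ : _root_.Module (IwasawaAlgebra 2) P)
      (_ : AddCommGroup X') (_ : _root_.Module (IwasawaAlgebra 2) X')
      (_ : AddCommGroup Y') (_ : _root_.Module (IwasawaAlgebra 2) Y')
      (_ : AddCommGroup Xr) (_ : _root_.Module (IwasawaAlgebra 2) Xr)
      (toX : P →ₗ[IwasawaAlgebra 2] X') (π : X' →ₗ[IwasawaAlgebra 2] Y')
      (cP : P →ₗ[IwasawaAlgebra 2] P) (cX : X' →ₗ[IwasawaAlgebra 2] X')
      (cY : Y' →ₗ[IwasawaAlgebra 2] Y')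
      (col : P →ₗ[IwasawaAlgebra 2] IwasawaAlgebra 2 × IwasawaAlgebra 2) (w₁ w₂ : P)
      (a b s : IwasawaAlgebra 2) (e : ℕ) (fd : (X' ⧸ LinearMap.range (cX - 1)) →ₗ[IwasawaAlgebra 2] Xr)
      (q : Xr →ₗ[IwasawaAlgebra 2] D.X)
      (fyr : (Y' ⧸ LinearMap.range (cY - 1)) →ₗ[IwasawaAlgebra 2] Yr.X),
      Function.Exact toX π ∧ Function.Surjective π ∧ toX ∘ₗ cP = cX ∘ₗ toX ∧ π ∘ₗ cX = cY ∘ₗ π ∧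
      Function.Injective col ∧
      col ∘ₗ cP = (LinearEquiv.prodComm (IwasawaAlgebra 2) (IwasawaAlgebra 2) (IwasawaAlgebra 2) :
        IwasawaAlgebra 2 × IwasawaAlgebra 2 →ₗ[IwasawaAlgebra 2]
          IwasawaAlgebra 2 × IwasawaAlgebra 2) ∘ₗ col ∧
      Finite ((IwasawaAlgebra 2 × IwasawaAlgebra 2) ⧸ LinearMap.range col) ∧
      toX w₁ = 0 ∧ toX w₂ = 0 ∧ col w₁ = (a, b) ∧ col w₂ = (b, a) ∧
      s ∉ IwasawaAlgebra.augIdealP 2 ∧ a + b = PowerSeries.C ((2 : ℤ_[2]) ^ e) * s * Gp ∧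
      Finite (Xr ⧸ LinearMap.range fd) ∧ Function.Surjective q ∧
      (e : ℕ∞) ≤ lengthAt (IwasawaAlgebra 2) (LinearMap.ker q)
          ⟨IwasawaAlgebra.augIdealP 2, IwasawaAlgebra.isPrime_augIdealP_holds 2⟩ ∧
      lengthAt (IwasawaAlgebra 2) (LinearMap.ker fyr)
          ⟨IwasawaAlgebra.augIdealP 2, IwasawaAlgebra.isPrime_augIdealP_holds 2⟩ = 0

/-- glue K₂ⁿᵉᵗʳ ⟹ MuIneqʳ — PROVED by att-p3 g3's kernel `AlignedTransportAtTwoFineRoad.muInequalityRelAtTwo_of_katoNetDataRel`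
(p601771): the displayed netted data give the registered inequality verbatim. -/
theorem muInequalityRel_of_katoNetDataRel : KatoNetDataRelAtTwo → MuInequalityRelAtTwo :=
  fun h =>
    Summit.BirchSwinnertonDyer.BirchSwinnertonDyer.Theorems.AlignedTransportAtTwoFineRoad.muInequalityRelAtTwo_of_katoNetDataRel
      h

end Summit.BirchSwinnertonDyer.BirchSwinnertonDyer.Cruxes.MainConjectureOfRankZeroBSDAtTwo.Birth

end
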